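import Summits.QuantumAdvantage.QuantumAdvantage.Theorems.NearExactIsExact.Negative.NoCaseATwelve
import Summits.QuantumAdvantage.QuantumAdvantage.Theorems.NearExactIsExact.Negative.TypeOTwelveDigits
import Summits.QuantumAdvantage.QuantumAdvantage.Theorems.CubicForrelationNearExactIsExactBentDuality

/-!
# Crux `CubicForrelation.NearExactIsExact` (stmt-QuantumAdvantage-14043) — n = 12: the DIGIT CLASS of a type-O cubic — cubic, `8 ∣ e`,
  and the capacity bound with `e` explicit (`e ≥ 1280 ⇒ Φ ≤ 57/64`)

Certificate seat `b2b-cforr-cert` (gen 33).  HONEST FRAMING: kernel-checked finite-slice lemmas (standard axioms) about cubic Boolean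
functions on 12 bits — the one-sided bookkeeping behind the reduction of the open window `(57/64, 29/32)` of the 12-bit slice to the
statement "E1280" (…TwelveDigitWeightReduction).  NO value of `θ₁₂`; NOT summit progress.

For a cubic `g` of TYPE O (`W_g = 16u`, all `u` odd) the DIGIT CLASS is `E = {x : u(x) ≡ ±1 (mod 8)}` (`= {d₁ = d₂}` for the digits of
`digit_two` / `digit_three`), `e := #E`.
* `tdw_digitClass_cubic`: `1_E` has algebraic degree `≤ 3`;  `tdw_e_mod8`: `8 ∣ e` (Ax);
* `tdw_typeO_cap_of_e`: `Σ_x |W_g(x)| ≤ 16·(15872 − e)` (the inequality inside `typeO_capacity`, with `e` kept as a parameter);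
* `tdw_forrelation_le_57_64`: `e ≥ 1280 ⇒ Φ(f,g) ≤ 57/64` for EVERY Boolean `f` (`16·(15872 − 1280) = 2¹⁸·57/64`).
So a type-O cubic can sit in a window pair only if its digit class is LIGHT (`e ≤ 1272`); by THEOREM W (`tow_weight_ge_1280`) this needs
`16 ∣ e` ("E1280-even", see …TwelveDigitWeightReduction, …TwelveDigitDualForm, …TwelveDigitPairing, …TwelveDigitNoPeriod).

References: J. Ax (1964) / R. J. McEliece (1972); C. Carlet (2021) §4.1; R. O'Donnell (2014) §1.4.  Axioms: the standard three.
-/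

set_option linter.dupNamespace false -- D-0017: single-problem summit ⇒ `QuantumAdvantage.QuantumAdvantage` by design

noncomputable section

namespace Summit.QuantumAdvantage.QuantumAdvantage.Theorems.CubicForrelation.NearExactIsExact

open Finset
open Literature.Computability.QuantumComplexity
open Literature.Computability.QuantumComplexity.DerivativeWalsh (W)
open Summit.QuantumAdvantage.QuantumAdvantage.Theorems.NearExactIsExact.Negative.TypeOTwelve
  (digit_two digit_three pt_odd pt_pm_one sum_u_sq)

section DigitClass

variable (g : (Fin (6 + 6) → Bool) → Bool) (u : (Fin (6 + 6) → Bool) → ℤ)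

/-- **The digit class is a cubic.**  For cubic `g` on 12 bits with `W_g = 16u`, all `u` odd: `x ↦ [u(x) ≡ ±1 (mod 8)]` has algebraic
degree `≤ 3` (it is `1 ⊕ [u₁ odd] ⊕ [u₂ odd]` for the digits `u = 2u₁ + 1`, `u₁ = 2u₂ + t`: `digit_two`, `digit_three`). [this work] -/
theorem tdw_digitClass_cubic (hg : IsDegLeFun 3 g) (hu : ∀ x, W (fun y => signOf (g y)) x = (2 : ℝ) ^ 4 * (u x : ℝ))
    (hodd : ∀ x, Odd (u x)) :
    IsDegLeFun 3 (fun x : Fin (6 + 6) → Bool => decide (u x % 8 = 1 ∨ u x % 8 = 7)) := by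
  have hodd' : ∀ x, u x % 2 = 1 := fun x => Int.odd_iff.1 (hodd x)
  obtain ⟨u₁, h1⟩ : ∃ u₁ : (Fin (6 + 6) → Bool) → ℤ, ∀ x, u x = 2 * u₁ x + 1 :=
    ⟨fun x => (u x - 1) / 2, fun x => by
      show u x = 2 * ((u x - 1) / 2) + 1
      have := hodd' x
      omega⟩
  obtain ⟨t, ht2⟩ : ∃ t : (Fin (6 + 6) → Bool) → ℤ, ∀ x, t x = u₁ x % 2 := ⟨fun x => u₁ x % 2, fun x => rfl⟩
  obtain ⟨u₂, h2⟩ : ∃ u₂ : (Fin (6 + 6) → Bool) → ℤ, ∀ x, u₁ x = 2 * u₂ x + t x :=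
    ⟨fun x => u₁ x / 2, fun x => by
      show u₁ x = 2 * (u₁ x / 2) + t x
      have := ht2 x
      omega⟩
  have ht : ∀ x, t x = if Odd (u₁ x) then 1 else 0 := fun x => by
    by_cases h : Odd (u₁ x)
    · rw [if_pos h, ht2 x]; exact Int.odd_iff.1 h
    · rw [if_neg h, ht2 x]; exact Int.even_iff.1 (Int.not_odd_iff_even.1 h)
  have hτ : IsDegLeFun 1 (fun x => decide (Odd (u₁ x))) := digit_two g u hg hu u₁ h1
  have hκ : IsDegLeFun 3 (fun x => decide (Odd (u₂ x))) := digit_three g u hg hu u₁ u₂ t h1 h2 ht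
  have hQ : IsDegLeFun 3 (fun x => ((decide (Odd (u₂ x)) ^^ decide (Odd (u₁ x))) ^^ true)) :=
    bb_isDegLeFun_bxor (bb_isDegLeFun_bxor hκ (hτ.mono (by norm_num))) (isDegLeFun_const 3 true)
  have hEq : (fun x : Fin (6 + 6) → Bool => decide (u x % 8 = 1 ∨ u x % 8 = 7)) =
      fun x => ((decide (Odd (u₂ x)) ^^ decide (Odd (u₁ x))) ^^ true) := by
    funext x
    have e1 := h1 x
    have e2 := h2 x
    have e3 := ht2 x
    have key : (Odd (u₂ x) ↔ Odd (u₁ x)) ↔ (u x % 8 = 1 ∨ u x % 8 = 7) := by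
      rw [Int.odd_iff, Int.odd_iff]
      omega
    by_cases a : Odd (u₂ x) <;> by_cases b : Odd (u₁ x)
    · have h : (u x % 8 = 1 ∨ u x % 8 = 7) := key.1 ⟨fun _ => b, fun _ => a⟩
      rw [decide_eq_true h, decide_eq_true a, decide_eq_true b]; rfl
    · have h : ¬ (u x % 8 = 1 ∨ u x % 8 = 7) := fun hh => b ((key.2 hh).1 a)
      rw [decide_eq_false h, decide_eq_true a, decide_eq_false b]; rfl
    · have h : ¬ (u x % 8 = 1 ∨ u x % 8 = 7) := fun hh => a ((key.2 hh).2 b)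
      rw [decide_eq_false h, decide_eq_false a, decide_eq_true b]; rfl
    · have h : (u x % 8 = 1 ∨ u x % 8 = 7) := key.1 ⟨fun ha => absurd ha a, fun hb => absurd hb b⟩
      rw [decide_eq_true h, decide_eq_false a, decide_eq_false b]; rfl
  rw [hEq]
  exact hQ

/-- **`8 ∣ e`.**  The digit class of a type-O cubic on 12 bits is the support of a cubic, so its size is a multiple of `8`
(Ax / McEliece, `stub_axParity` with `d = 3` on the whole cube). [this work] -/
theorem tdw_e_mod8 (hg : IsDegLeFun 3 g) (hu : ∀ x, W (fun y => signOf (g y)) x = (2 : ℝ) ^ 4 * (u x : ℝ))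
    (hodd : ∀ x, Odd (u x)) :
    (8 : ℕ) ∣ #(univ.filter fun x : Fin (6 + 6) → Bool => u x % 8 = 1 ∨ u x % 8 = 7) := by
  have hQ := tdw_digitClass_cubic g u hg hu hodd
  obtain ⟨z, hz⟩ := stub_axParity (6 + 6) 3 (fun x => decide (u x % 8 = 1 ∨ u x % 8 = 7)) univ (by norm_num) hQ
  have hexp : (#(univ : Finset (Fin (6 + 6))) + 3 - 1) / 3 = 4 := by rw [card_univ, Fintype.card_fin]
  rw [hexp] at hz
  rw [bb_sum_signOf] at hz
  have h1 : (univ.filter fun x : Fin (6 + 6) → Bool => ∀ i, x i = true → i ∈ (univ : Finset (Fin (6 + 6)))) = univ := by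
    ext x; simp
  have h2 : (univ.filter fun x : Fin (6 + 6) → Bool =>
      (∀ i, x i = true → i ∈ (univ : Finset (Fin (6 + 6)))) ∧ decide (u x % 8 = 1 ∨ u x % 8 = 7) = true) =
      univ.filter fun x : Fin (6 + 6) → Bool => u x % 8 = 1 ∨ u x % 8 = 7 := by
    ext x; simp
  rw [h1, h2] at hz
  have hcardU : (#(univ : Finset (Fin (6 + 6) → Bool)) : ℝ) = 4096 := by
    rw [card_univ, Fintype.card_fun, Fintype.card_bool, Fintype.card_fin]; norm_num
  rw [hcardU] at hz
  have hzint : (4096 : ℤ) - 2 * (#(univ.filter fun x : Fin (6 + 6) → Bool => u x % 8 = 1 ∨ u x % 8 = 7) : ℤ) = 2 ^ 4 * z := by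
    have h' : ((4096 : ℤ) : ℝ) - 2 * ((#(univ.filter fun x : Fin (6 + 6) → Bool => u x % 8 = 1 ∨ u x % 8 = 7) : ℤ) : ℝ) =
        (((2 : ℤ) ^ 4 * z : ℤ) : ℝ) := by
      push_cast
      linarith
    exact_mod_cast h'
  have h8 : (8 : ℤ) ∣ (#(univ.filter fun x : Fin (6 + 6) → Bool => u x % 8 = 1 ∨ u x % 8 = 7) : ℤ) := ⟨256 - z, by omega⟩
  exact_mod_cast h8

/-- **Type-O capacity with the digit class explicit.**  For cubic `g` on 12 bits with `W_g = 16u`, all `u` odd, and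
`e = #{x : u(x) ≡ ±1 (mod 8)}`: `Σ_x |W_g(x)| ≤ 16·(15872 − e)` (pointwise `8|u| + 8·[u ≡ ±1 (8)] ≤ u² + 15`, Parseval `Σu² = 2¹⁶`).
This is the first half of `typeO_capacity` with `e` kept as a parameter. [this work] -/
theorem tdw_typeO_cap_of_e (hu : ∀ x, W (fun y => signOf (g y)) x = (2 : ℝ) ^ 4 * (u x : ℝ)) (hodd : ∀ x, Odd (u x)) :
    ∑ x, |W (fun y => signOf (g y)) x| ≤
      16 * (15872 - (#(univ.filter fun x : Fin (6 + 6) → Bool => u x % 8 = 1 ∨ u x % 8 = 7) : ℝ)) := by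
  have hodd' : ∀ x, u x % 2 = 1 := fun x => Int.odd_iff.1 (hodd x)
  have hpar : ∑ x, u x ^ 2 = 2 ^ 16 := sum_u_sq g u hu
  have hkey : ∀ x, 8 * |u x| + 8 * (if (u x % 8 = 1 ∨ u x % 8 = 7) then 1 else 0 : ℤ) ≤ u x ^ 2 + 15 := by
    intro x
    by_cases hq : u x % 8 = 1 ∨ u x % 8 = 7
    · rw [if_pos hq]
      have := pt_pm_one (u x) hq
      linarith
    · rw [if_neg hq]
      have := pt_odd (u x) (hodd' x)
      linarith
  have hcardU : (#(univ : Finset (Fin (6 + 6) → Bool)) : ℤ) = 2 ^ 12 := by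
    rw [card_univ, Fintype.card_fun, Fintype.card_bool, Fintype.card_fin]
    norm_num
  have hsumkey : 8 * ∑ x, |u x| + 8 * (#(univ.filter fun x : Fin (6 + 6) → Bool => u x % 8 = 1 ∨ u x % 8 = 7) : ℤ) ≤
      2 ^ 16 + 15 * 2 ^ 12 := by
    have h := sum_le_sum fun x (_ : x ∈ univ) => hkey x
    rw [sum_add_distrib, ← mul_sum, ← mul_sum, sum_boole, sum_add_distrib, hpar, sum_const, nsmul_eq_mul,
      hcardU] at h
    linarith
  have hW : ∑ x, |W (fun y => signOf (g y)) x| = 16 * ((∑ x, |u x| : ℤ) : ℝ) := by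
    push_cast
    rw [mul_sum]
    refine sum_congr rfl fun x _ => ?_
    rw [hu x, abs_mul, abs_of_pos (by positivity : (0 : ℝ) < 2 ^ 4)]
    norm_num
  have hS : (∑ x, |u x| : ℤ) ≤ 15872 - (#(univ.filter fun x : Fin (6 + 6) → Bool => u x % 8 = 1 ∨ u x % 8 = 7) : ℤ) := by
    linarith
  have hSR : ((∑ x, |u x| : ℤ) : ℝ) ≤
      15872 - (#(univ.filter fun x : Fin (6 + 6) → Bool => u x % 8 = 1 ∨ u x % 8 = 7) : ℝ) := by
    exact_mod_cast hS
  rw [hW]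
  linarith

/-- **A heavy digit class keeps a type-O cubic out of the window.**  If `g` is a type-O cubic on 12 bits whose digit class has
`e ≥ 1280` points, then `Φ(f,g) ≤ 57/64` for every Boolean `f` (`16·(15872 − 1280) = 2¹⁸·57/64`). [this work] -/
theorem tdw_forrelation_le_57_64 (f : (Fin (6 + 6) → Bool) → Bool)
    (hu : ∀ x, W (fun y => signOf (g y)) x = (2 : ℝ) ^ 4 * (u x : ℝ)) (hodd : ∀ x, Odd (u x))
    (he : 1280 ≤ #(univ.filter fun x : Fin (6 + 6) → Bool => u x % 8 = 1 ∨ u x % 8 = 7)) :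
    forrelation f g ≤ 57 / 64 := by
  have hcap := tdw_typeO_cap_of_e g u hu hodd
  have heR : (1280 : ℝ) ≤ (#(univ.filter fun x : Fin (6 + 6) → Bool => u x % 8 = 1 ∨ u x % 8 = 7) : ℝ) := by
    exact_mod_cast he
  refine tw_forrelation_le_of_cap f g (c := 57 / 64) ?_
  have h18 : (2 : ℝ) ^ (3 * 6) * (57 / 64) = 16 * (15872 - 1280) := by norm_num
  rw [h18]
  linarith

end DigitClass

end Summit.QuantumAdvantage.QuantumAdvantage.Theorems.CubicForrelation.NearExactIsExact

end
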